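import Mathlib
import HarnessLib
import Summits.Ventures.LatticeQCDFlow.Scaling.TorusTransferOfLimits2D
import Summits.Ventures.LatticeQCDFlow.Scaling.TorusDiagonalLimit2D
import Summits.Ventures.LatticeQCDFlow.Scaling.LossDiagonalRate
import Summits.Ventures.LatticeQCDFlow.Scaling.TorusGiniSlope2D

/-!
# LatticeQCDFlow / Scaling — THE WINDOW `β√V → c` ON THE TORUS, ESS and training loss: for every coupling
# sequence with `β_L·L → c` (any real `c`; in particular `β = c/L`) the untrained sampler on the periodic
# `L × L` torus has Kish ESS `→ e^{−c²σ²}` and reverse loss `→ c²σ²/2`, `σ² = Var_Haar(Re tr ρ)`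

HONEST FRAMING: exact (Metropolis-corrected) sampling algorithms for lattice gauge theory;
figures of merit are autocorrelation/cost numbers at stated couplings and volumes; no
continuum-physics claim.

Venture `LatticeQCDFlow` (cell pub-lqcd), topic `Scaling`; FANOUT row 3 (`s0-u1-a`, S0-B
implementation A, GEN-21).  NEW WORK of the cell, no numerics, NO definition; companion of
`Scaling/TorusCouplingSequences2D` (the acceptance along `β_L·L → c`).  GEN-20's RATE
`|cgf(u) − u²σ²/2| ≤ 2|u|³K³` (`Scaling/LossDiagonalRate.abs_cgf_sub_le`, `abs_log_essFrac_add_le`) makes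
the factorised per-plaquette loss `ℓ(β) = cgf_{Re tr ρ − m}(β)` and ESS rate
`z(β)²/z(2β) = e^{2cgf(β) − cgf(2β)}` (`Scaling/TorusDiagonalLimit2D`, §1) explicit to second order,
uniformly; so along ANY `β_k√n_k → c` (`n_k = (k+2)² − 1`) the factorised totals converge —
`n_k·ℓ(β_k) → c²σ²/2`, `(z²/z(2·))^{n_k} → e^{−c²σ²}` — and GEN-21's transfer theorems
(`Scaling/TorusTransferOfLimits2D`) carry both to the torus:

* §1 (window parametrisation `tendsto_sqrt_punctured_div`, `tendsto_mul_sqrt_punctured`, `tendsto_zero_of_mul_tendsto`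
  imported from `Scaling/TorusGiniSlope2D`), `tendsto_nat_mul_sq_of_mul_sqrt_tendsto` (`n_kβ_k² → c²`), `tendsto_nat_mul_cube_of_mul_sqrt_tendsto`
  (`n_k|β_k|³ → 0`), **`factorised_loss_tendsto_of_mul_sqrt_tendsto`** (`n_k·cgf(β_k) → c²σ²/2`),
  **`factorised_essFrac_tendsto_of_mul_sqrt_tendsto`** (`(M(β_k)²/M(2β_k))^{n_k} → e^{−c²σ²}`) — cf.
  GEN-20's staged `Scaling/LossEssDictionary` (`n·cgf(β_n) → D ⇔ β_n√n → √(2D/σ²)`, `β_n ≥ 0`), here for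
  signed couplings along the torus subsequence, from the rate alone;
* §2 **`torus_essFrac_tendsto_of_mul_tendsto`** (`β_k(k+2) → c ⇒ ESS_T → e^{−c²σ²}`),
  **`torus_reverseKL_tendsto_of_mul_tendsto`** (`⇒ D(Haar^{⊗E} ‖ Wilson_{β_k}) → c²σ²/2`), and the
  `β = c/L` cases **`torus_essFrac_window_tendsto`**, **`torus_reverseKL_window_tendsto`**.

With `Scaling/TorusCouplingSequences2D`: along `β√V → c` the untrained torus sampler has loss `D = c²σ²/2`,
`ESS = e^{−2D}` and acceptance `erfc(√(D/2))` in the large-volume limit — the loss dictionary on the torus,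
window form.  NOT CLAIMED: rates on the torus; `d ≥ 3`; any value at the cell's `(β, L)`; nothing
re-scored, SEALED.md untouched.
-/

noncomputable section

namespace Summit.Ventures.LatticeQCDFlow.Theory2

open MeasureTheory ProbabilityTheory Filter Finset Real Set
open Literature.MathematicalPhysics.QuantumFieldTheory
open scoped Topology

/-! ## §1 Factorised totals along `β_k√n_k → c` from GEN-20's rate -/

section Factorised

/-- `β_k√n_k → c ⇒ n_k β_k² → c²`. [folklore] -/
theorem tendsto_nat_mul_sq_of_mul_sqrt_tendsto {n : ℕ → ℕ} {β : ℕ → ℝ} {c : ℝ}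
    (hβ : Tendsto (fun k => β k * Real.sqrt (n k)) atTop (𝓝 c)) :
    Tendsto (fun k => (n k : ℝ) * β k ^ 2) atTop (𝓝 (c ^ 2)) := by
  refine (hβ.pow 2).congr fun k => ?_
  rw [mul_pow, Real.sq_sqrt (Nat.cast_nonneg _)]
  ring

/-- `β_k√n_k → c`, `n_k → ∞ ⇒ n_k |β_k|³ → 0`. [folklore] -/
theorem tendsto_nat_mul_cube_of_mul_sqrt_tendsto {n : ℕ → ℕ} (hn : Tendsto n atTop atTop) {β : ℕ → ℝ}
    {c : ℝ} (hβ : Tendsto (fun k => β k * Real.sqrt (n k)) atTop (𝓝 c)) :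
    Tendsto (fun k => (n k : ℝ) * |β k| ^ 3) atTop (𝓝 0) := by
  -- `n|β|³ = |β√n|³ / √n`
  have h3 : Tendsto (fun k => |β k * Real.sqrt (n k)| ^ 3) atTop (𝓝 (|c| ^ 3)) := (hβ.abs).pow 3
  have hs : Tendsto (fun k => Real.sqrt (n k : ℝ)) atTop atTop :=
    (tendsto_rpow_atTop (by norm_num : (0 : ℝ) < 1 / 2)).comp
      ((tendsto_natCast_atTop_atTop (R := ℝ)).comp hn) |>.congr fun k => by
        simp [Function.comp_apply, Real.sqrt_eq_rpow]
  have h := h3.div_atTop hs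
  refine h.congr' ?_
  filter_upwards [hn.eventually (eventually_gt_atTop 0)] with k hk
  have hsq : 0 < Real.sqrt (n k : ℝ) := Real.sqrt_pos.2 (Nat.cast_pos.2 hk)
  rw [abs_mul, abs_of_pos hsq, mul_pow, div_eq_iff hsq.ne']
  have e3 : Real.sqrt (n k : ℝ) ^ 3 = (n k : ℝ) * Real.sqrt (n k : ℝ) := by
    rw [pow_succ, Real.sq_sqrt (Nat.cast_nonneg _)]
  rw [e3]; ring

variable {Y : Type*} {mY : MeasurableSpace Y} (ν : Measure Y) [IsProbabilityMeasure ν] {h : Y → ℝ}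

/-- **The factorised total loss along `β_k√n_k → c`**: `n_k·cgf(β_k) → c²σ²/2` for a bounded centred
statistic (GEN-20's rate `abs_cgf_sub_le`; any sign of `c`). [ours] -/
theorem factorised_loss_tendsto_of_mul_sqrt_tendsto (hm : Measurable h) {K : ℝ} (hK : ∀ y, |h y| ≤ K)
    (h0 : ∫ y, h y ∂ν = 0) {n : ℕ → ℕ} (hn : Tendsto n atTop atTop) {β : ℕ → ℝ} {c : ℝ}
    (hβ : Tendsto (fun k => β k * Real.sqrt (n k)) atTop (𝓝 c)) :
    Tendsto (fun k => (n k : ℝ) * cgf h ν (β k)) atTop (𝓝 (c ^ 2 * Var[h; ν] / 2)) := by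
  obtain ⟨y0, -⟩ := nonempty_of_measure_ne_zero (show ν Set.univ ≠ 0 by simp)
  have hK0 : 0 ≤ K := (abs_nonneg _).trans (hK y0)
  have hβ0 : Tendsto β atTop (𝓝 0) := by
    have hs : Tendsto (fun k => Real.sqrt (n k : ℝ)) atTop atTop :=
      (tendsto_rpow_atTop (by norm_num : (0 : ℝ) < 1 / 2)).comp
        ((tendsto_natCast_atTop_atTop (R := ℝ)).comp hn) |>.congr fun k => by
          simp [Function.comp_apply, Real.sqrt_eq_rpow]
    refine (hβ.div_atTop hs).congr' ?_
    filter_upwards [hn.eventually (eventually_gt_atTop 0)] with k hk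
    have hsq : 0 < Real.sqrt (n k : ℝ) := Real.sqrt_pos.2 (Nat.cast_pos.2 hk)
    field_simp
  have hmain : Tendsto (fun k => (n k : ℝ) * β k ^ 2 * Var[h; ν] / 2) atTop (𝓝 (c ^ 2 * Var[h; ν] / 2)) :=
    ((tendsto_nat_mul_sq_of_mul_sqrt_tendsto hβ).mul_const _).div_const _
  have herr : Tendsto (fun k => 2 * ((n k : ℝ) * |β k| ^ 3) * K ^ 3) atTop (𝓝 0) := by
    have := ((tendsto_nat_mul_cube_of_mul_sqrt_tendsto hn hβ).const_mul 2).mul_const (K ^ 3)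
    simpa using this
  -- eventually `|β_k| K ≤ 1/2`, where the rate applies
  have hev : ∀ᶠ k in atTop, |β k| * K ≤ 1 / 2 := by
    rcases hK0.eq_or_lt with hz | hpos
    · exact Eventually.of_forall fun k => by rw [← hz, mul_zero]; norm_num
    · have h1 : Tendsto (fun k => |β k| * K) atTop (𝓝 (|(0:ℝ)| * K)) := hβ0.abs.mul_const K
      rw [abs_zero, zero_mul] at h1
      exact (tendsto_order.1 h1).2 (1 / 2) (by norm_num) |>.mono fun k hk => hk.le
  have hb0 : Tendsto (fun k => |(n k : ℝ) * β k ^ 2 * Var[h; ν] / 2 - c ^ 2 * Var[h; ν] / 2| +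
      2 * ((n k : ℝ) * |β k| ^ 3) * K ^ 3) atTop (𝓝 0) := by
    have hb := (hmain.sub_const (c ^ 2 * Var[h; ν] / 2)).abs.add herr
    rwa [sub_self, abs_zero, zero_add] at hb
  rw [tendsto_iff_dist_tendsto_zero]
  refine squeeze_zero' (Eventually.of_forall fun k => dist_nonneg) ?_ hb0
  filter_upwards [hev] with k hk
  have hr := abs_cgf_sub_le ν hm hK h0 (u := β k) hk
  rw [Real.dist_eq]
  have e : (n k : ℝ) * cgf h ν (β k) - c ^ 2 * Var[h; ν] / 2 =
      (n k : ℝ) * (cgf h ν (β k) - β k ^ 2 * Var[h; ν] / 2) +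
        ((n k : ℝ) * β k ^ 2 * Var[h; ν] / 2 - c ^ 2 * Var[h; ν] / 2) := by ring
  rw [e]
  calc |(n k : ℝ) * (cgf h ν (β k) - β k ^ 2 * Var[h; ν] / 2) +
          ((n k : ℝ) * β k ^ 2 * Var[h; ν] / 2 - c ^ 2 * Var[h; ν] / 2)|
      ≤ |(n k : ℝ) * (cgf h ν (β k) - β k ^ 2 * Var[h; ν] / 2)| +
          |(n k : ℝ) * β k ^ 2 * Var[h; ν] / 2 - c ^ 2 * Var[h; ν] / 2| := abs_add_le _ _
    _ = (n k : ℝ) * |cgf h ν (β k) - β k ^ 2 * Var[h; ν] / 2| +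
          |(n k : ℝ) * β k ^ 2 * Var[h; ν] / 2 - c ^ 2 * Var[h; ν] / 2| := by
        rw [abs_mul, Nat.abs_cast]
    _ ≤ (n k : ℝ) * (2 * |β k| ^ 3 * K ^ 3) +
          |(n k : ℝ) * β k ^ 2 * Var[h; ν] / 2 - c ^ 2 * Var[h; ν] / 2| := by gcongr
    _ = _ := by ring

/-- **The factorised ESS exponent along `β_k√n_k → c`**: `n_k·(2cgf(β_k) − cgf(2β_k)) → −c²σ²` (GEN-20's
rate `abs_log_essFrac_add_le`). [ours] -/
theorem factorised_logEss_tendsto_of_mul_sqrt_tendsto (hm : Measurable h) {K : ℝ} (hK : ∀ y, |h y| ≤ K)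
    (h0 : ∫ y, h y ∂ν = 0) {n : ℕ → ℕ} (hn : Tendsto n atTop atTop) {β : ℕ → ℝ} {c : ℝ}
    (hβ : Tendsto (fun k => β k * Real.sqrt (n k)) atTop (𝓝 c)) :
    Tendsto (fun k => (n k : ℝ) * (2 * cgf h ν (β k) - cgf h ν (2 * β k))) atTop
      (𝓝 (-(c ^ 2 * Var[h; ν]))) := by
  obtain ⟨y0, -⟩ := nonempty_of_measure_ne_zero (show ν Set.univ ≠ 0 by simp)
  have hK0 : 0 ≤ K := (abs_nonneg _).trans (hK y0)
  have hβ0 : Tendsto β atTop (𝓝 0) := by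
    have hs : Tendsto (fun k => Real.sqrt (n k : ℝ)) atTop atTop :=
      (tendsto_rpow_atTop (by norm_num : (0 : ℝ) < 1 / 2)).comp
        ((tendsto_natCast_atTop_atTop (R := ℝ)).comp hn) |>.congr fun k => by
          simp [Function.comp_apply, Real.sqrt_eq_rpow]
    refine (hβ.div_atTop hs).congr' ?_
    filter_upwards [hn.eventually (eventually_gt_atTop 0)] with k hk
    have hsq : 0 < Real.sqrt (n k : ℝ) := Real.sqrt_pos.2 (Nat.cast_pos.2 hk)
    field_simp
  have hmain : Tendsto (fun k => -((n k : ℝ) * β k ^ 2 * Var[h; ν])) atTop (𝓝 (-(c ^ 2 * Var[h; ν]))) :=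
    ((tendsto_nat_mul_sq_of_mul_sqrt_tendsto hβ).mul_const _).neg
  have herr : Tendsto (fun k => 20 * ((n k : ℝ) * |β k| ^ 3) * K ^ 3) atTop (𝓝 0) := by
    have := ((tendsto_nat_mul_cube_of_mul_sqrt_tendsto hn hβ).const_mul 20).mul_const (K ^ 3)
    simpa using this
  have hev : ∀ᶠ k in atTop, |β k| * K ≤ 1 / 4 := by
    rcases hK0.eq_or_lt with hz | hpos
    · exact Eventually.of_forall fun k => by rw [← hz, mul_zero]; norm_num
    · have h1 : Tendsto (fun k => |β k| * K) atTop (𝓝 (|(0:ℝ)| * K)) := hβ0.abs.mul_const K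
      rw [abs_zero, zero_mul] at h1
      exact (tendsto_order.1 h1).2 (1 / 4) (by norm_num) |>.mono fun k hk => hk.le
  have hb0 : Tendsto (fun k => |-((n k : ℝ) * β k ^ 2 * Var[h; ν]) - -(c ^ 2 * Var[h; ν])| +
      20 * ((n k : ℝ) * |β k| ^ 3) * K ^ 3) atTop (𝓝 0) := by
    have hb := (hmain.sub_const (-(c ^ 2 * Var[h; ν]))).abs.add herr
    rwa [sub_self, abs_zero, zero_add] at hb
  rw [tendsto_iff_dist_tendsto_zero]
  refine squeeze_zero' (Eventually.of_forall fun k => dist_nonneg) ?_ hb0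
  filter_upwards [hev] with k hk
  have hr := abs_log_essFrac_add_le ν hm hK h0 (β := β k) hk
  rw [Real.dist_eq]
  have e : (n k : ℝ) * (2 * cgf h ν (β k) - cgf h ν (2 * β k)) - -(c ^ 2 * Var[h; ν]) =
      (n k : ℝ) * (2 * cgf h ν (β k) - cgf h ν (2 * β k) + β k ^ 2 * Var[h; ν]) +
        (-((n k : ℝ) * β k ^ 2 * Var[h; ν]) - -(c ^ 2 * Var[h; ν])) := by ring
  rw [e]
  calc |(n k : ℝ) * (2 * cgf h ν (β k) - cgf h ν (2 * β k) + β k ^ 2 * Var[h; ν]) +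
          (-((n k : ℝ) * β k ^ 2 * Var[h; ν]) - -(c ^ 2 * Var[h; ν]))|
      ≤ |(n k : ℝ) * (2 * cgf h ν (β k) - cgf h ν (2 * β k) + β k ^ 2 * Var[h; ν])| +
          |-((n k : ℝ) * β k ^ 2 * Var[h; ν]) - -(c ^ 2 * Var[h; ν])| := abs_add_le _ _
    _ = (n k : ℝ) * |2 * cgf h ν (β k) - cgf h ν (2 * β k) + β k ^ 2 * Var[h; ν]| +
          |-((n k : ℝ) * β k ^ 2 * Var[h; ν]) - -(c ^ 2 * Var[h; ν])| := by
        rw [abs_mul, Nat.abs_cast]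
    _ ≤ (n k : ℝ) * (20 * |β k| ^ 3 * K ^ 3) +
          |-((n k : ℝ) * β k ^ 2 * Var[h; ν]) - -(c ^ 2 * Var[h; ν])| := by gcongr
    _ = _ := by ring

/-- **The factorised Kish fraction along `β_k√n_k → c`**: `(M(β_k)²/M(2β_k))^{n_k} → e^{−c²σ²}`. [ours] -/
theorem factorised_essFrac_tendsto_of_mul_sqrt_tendsto (hm : Measurable h) {K : ℝ} (hK : ∀ y, |h y| ≤ K)
    (h0 : ∫ y, h y ∂ν = 0) {n : ℕ → ℕ} (hn : Tendsto n atTop atTop) {β : ℕ → ℝ} {c : ℝ}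
    (hβ : Tendsto (fun k => β k * Real.sqrt (n k)) atTop (𝓝 c)) :
    Tendsto (fun k => (mgf h ν (β k) ^ 2 / mgf h ν (2 * β k)) ^ n k) atTop
      (𝓝 (Real.exp (-(c ^ 2 * Var[h; ν])))) := by
  have hb : ∀ᵐ y ∂ν, h y ∈ Set.Icc (-K) K := ae_of_all _ fun y => abs_le.1 (hK y)
  have hiE : ∀ t : ℝ, Integrable (fun y => Real.exp (t * h y)) ν := fun t =>
    integrable_exp_mul_of_mem_Icc hm.aemeasurable hb
  have hlim := (Real.continuous_exp.tendsto _).comp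
    (factorised_logEss_tendsto_of_mul_sqrt_tendsto ν hm hK h0 hn hβ)
  refine hlim.congr fun k => ?_
  have hk : mgf h ν (β k) ^ 2 / mgf h ν (2 * β k) = Real.exp (2 * cgf h ν (β k) - cgf h ν (2 * β k)) := by
    rw [← exp_cgf (hiE (β k)), ← exp_cgf (hiE (2 * β k)), Real.exp_sub,
      show (2 : ℝ) * cgf h ν (β k) = ((2 : ℕ) : ℝ) * cgf h ν (β k) by norm_num, Real.exp_nat_mul]
  simp only [Function.comp_apply]
  rw [hk, ← Real.exp_nat_mul]

end Factorised

/-! ## §2 ESS and reverse loss along `β_L·L → c` on the torus -/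

section Window

variable {N : ℕ} {G : Type*} [Group G] [TopologicalSpace G] [IsTopologicalGroup G]
  [CompactSpace G] [SecondCountableTopology G] [MeasurableSpace G] [BorelSpace G]
  (ρ : G →* Matrix (Fin N) (Fin N) ℂ)

/-- **THE TORUS ESS ALONG `β_L·L → c`**: for every compact second-countable `G`, continuous `ρ` and couplings
with `β_k·(k + 2) → c` (any real `c`): the Kish fraction `(∫p)²/∫p²` of the untrained exact sampler on the
periodic `(k+2) × (k+2)` torus tends to `e^{−c²σ²}`, `σ² = Var_Haar(Re tr ρ)`. [ours] -/
theorem torus_essFrac_tendsto_of_mul_tendsto (hρ : Continuous ρ) {β : ℕ → ℝ} {c : ℝ}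
    (hβ : Tendsto (fun k : ℕ => β k * ((k : ℝ) + 2)) atTop (𝓝 c)) :
    Tendsto (fun k : ℕ =>
        (∫ U, Real.exp (-β k * wilsonAction ρ U) / ∫ V, Real.exp (-β k * wilsonAction ρ V)
              ∂(Measure.pi fun _ : Edge 2 (k + 2) => haarProbability G)
            ∂(Measure.pi fun _ : Edge 2 (k + 2) => haarProbability G)) ^ 2 /
          ∫ U, (Real.exp (-β k * wilsonAction ρ U) / ∫ V, Real.exp (-β k * wilsonAction ρ V)
              ∂(Measure.pi fun _ : Edge 2 (k + 2) => haarProbability G)) ^ 2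
            ∂(Measure.pi fun _ : Edge 2 (k + 2) => haarProbability G))
      atTop (𝓝 (Real.exp (-(c ^ 2 * Var[fun g : G => (ρ g).trace.re; haarProbability G])))) := by
  obtain ⟨hXm, hXb, hX0, hVar⟩ := centredTrace_facts ρ hρ
  set m : ℝ := ∫ h, (ρ h).trace.re ∂(haarProbability G) with hm
  have hF := factorised_essFrac_tendsto_of_mul_sqrt_tendsto (haarProbability G) hXm hXb hX0
    tendsto_puncturedVolume_atTop (tendsto_mul_sqrt_punctured hβ)
  rw [hVar] at hF
  refine torus_essFrac_tendsto_of_factorised_tendsto ρ hρ (tendsto_zero_of_mul_tendsto hβ) ?_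
  refine hF.congr fun k => ?_
  rw [oneplaquette_ratio_eq_mgf ρ hρ (β k)]

/-- **THE TORUS REVERSE LOSS ALONG `β_L·L → c`**: `D(Haar^{⊗E} ‖ Wilson_{β_k}) → c²σ²/2` on the periodic
`(k+2) × (k+2)` torus whenever `β_k·(k + 2) → c`. [ours] -/
theorem torus_reverseKL_tendsto_of_mul_tendsto (hρ : Continuous ρ) {β : ℕ → ℝ} {c : ℝ}
    (hβ : Tendsto (fun k : ℕ => β k * ((k : ℝ) + 2)) atTop (𝓝 c)) :
    Tendsto (fun k : ℕ =>
        ∫ U, Real.log (1 / (Real.exp (-β k * wilsonAction ρ U) /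
            ∫ V, Real.exp (-β k * wilsonAction ρ V) ∂(Measure.pi fun _ : Edge 2 (k + 2) => haarProbability G)))
          ∂(Measure.pi fun _ : Edge 2 (k + 2) => haarProbability G))
      atTop (𝓝 (c ^ 2 * Var[fun g : G => (ρ g).trace.re; haarProbability G] / 2)) := by
  obtain ⟨hXm, hXb, hX0, hVar⟩ := centredTrace_facts ρ hρ
  set m : ℝ := ∫ h, (ρ h).trace.re ∂(haarProbability G) with hm
  have hF := factorised_loss_tendsto_of_mul_sqrt_tendsto (haarProbability G) hXm hXb hX0
    tendsto_puncturedVolume_atTop (tendsto_mul_sqrt_punctured hβ)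
  rw [hVar] at hF
  refine torus_reverseKL_tendsto_of_factorised_tendsto ρ hρ (tendsto_zero_of_mul_tendsto hβ) ?_
  refine hF.congr fun k => ?_
  rw [oneplaquette_loss_eq_cgf ρ hρ (β k)]

/-- **The window `β = c/L`, ESS**: at `β_L = c/L` the torus Kish fraction tends to `e^{−c²σ²}`. [ours] -/
theorem torus_essFrac_window_tendsto (hρ : Continuous ρ) (c : ℝ) :
    Tendsto (fun k : ℕ =>
        (∫ U, Real.exp (-(c / ((k : ℝ) + 2)) * wilsonAction ρ U) /
              ∫ V, Real.exp (-(c / ((k : ℝ) + 2)) * wilsonAction ρ V)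
                ∂(Measure.pi fun _ : Edge 2 (k + 2) => haarProbability G)
            ∂(Measure.pi fun _ : Edge 2 (k + 2) => haarProbability G)) ^ 2 /
          ∫ U, (Real.exp (-(c / ((k : ℝ) + 2)) * wilsonAction ρ U) /
              ∫ V, Real.exp (-(c / ((k : ℝ) + 2)) * wilsonAction ρ V)
                ∂(Measure.pi fun _ : Edge 2 (k + 2) => haarProbability G)) ^ 2
            ∂(Measure.pi fun _ : Edge 2 (k + 2) => haarProbability G))
      atTop (𝓝 (Real.exp (-(c ^ 2 * Var[fun g : G => (ρ g).trace.re; haarProbability G])))) := by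
  refine torus_essFrac_tendsto_of_mul_tendsto ρ hρ (β := fun k => c / ((k : ℝ) + 2)) ?_
  refine tendsto_const_nhds.congr fun k => ?_
  have hpos : (0 : ℝ) < (k : ℝ) + 2 := by positivity
  field_simp

/-- **The window `β = c/L`, reverse loss**: at `β_L = c/L` the torus reverse loss tends to `c²σ²/2`. [ours] -/
theorem torus_reverseKL_window_tendsto (hρ : Continuous ρ) (c : ℝ) :
    Tendsto (fun k : ℕ =>
        ∫ U, Real.log (1 / (Real.exp (-(c / ((k : ℝ) + 2)) * wilsonAction ρ U) /
            ∫ V, Real.exp (-(c / ((k : ℝ) + 2)) * wilsonAction ρ V)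
              ∂(Measure.pi fun _ : Edge 2 (k + 2) => haarProbability G)))
          ∂(Measure.pi fun _ : Edge 2 (k + 2) => haarProbability G))
      atTop (𝓝 (c ^ 2 * Var[fun g : G => (ρ g).trace.re; haarProbability G] / 2)) := by
  refine torus_reverseKL_tendsto_of_mul_tendsto ρ hρ (β := fun k => c / ((k : ℝ) + 2)) ?_
  refine tendsto_const_nhds.congr fun k => ?_
  have hpos : (0 : ℝ) < (k : ℝ) + 2 := by positivity
  field_simp

end Window

end Summit.Ventures.LatticeQCDFlow.Theory2

end
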